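import Summits.BirchSwinnertonDyer.BirchSwinnertonDyer.Theses.PAdicOrder

/-!
# Sketch — crux-ideate stmt-BirchSwinnertonDyer-0487 (PAdicOrderThesisR2), ideator 1, round 1

First lemmas of the idea cards (they must ELABORATE; proofs are a bonus).

* Card `regular-prime-cut`: the target X follows from
  (Λ_MW) one "E-regular" odd good ordinary prime per curve, in ORDER form `ord_T L_p ≤ r_MW`
  (the attack is the stronger, mod-p checkable λ-form: some Taylor coefficient of index ≤ r_MW
  is a p-adic unit),
  (KATO) the route's support item `PAdicOrderKatoSideR2` (Kato 2004 Thm 18.4, fact in tree),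
  (DOM) the Mazur–Tate–Teitelbaum direction `r_an ≤ ord_T L_p` at ordinary p (known for
  `r_an ≤ 3`), and
  (UB) no excess rank `r_MW ≤ r_an` (the crux `SqueezeUBR2` shared by routes Squeeze /
  HigherGrossZagier) — by pure order bookkeeping in `ℕ∞`.  PROVED below (no sorry).
-/

namespace Summit.BirchSwinnertonDyer.BirchSwinnertonDyer.Cruxes.PAdicOrderThesisR2.RegularPrimeCut

open Summit.BirchSwinnertonDyer.BirchSwinnertonDyer.Theses.PAdicOrder
open Literature.NumberTheory.EllipticCurves Literature.NumberTheory.EllipticCurves.ModularForms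

/-- (Λ_MW, order form) every elliptic curve over `ℚ` (globally minimal `W`) has an ODD good
ordinary prime `p` and a newform `f` with `ord_{T=0} L_p(f, α_p, T) ≤ rank E(ℚ)`.
With Kato's inequality this pins `ord_T L_p = corank Sel_{p^∞} = rank` at that prime, hence
`Ш(E)[p^∞]` finite and `X(E/ℚ_∞) ⊗ ℚ_p` semisimple at `T` there.  Sufficient (the attack):
some coefficient `[T^k] L_p`, `k ≤ r_MW`, is a `p`-adic unit ("`p` is E-regular"). -/
def ExistsRegularPrime : Prop :=
  ∀ (W : WeierstrassCurve ℚ) [W.IsElliptic] [W.IsGloballyMinimal],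
    ∃ (p : ℕ) (_ : Fact p.Prime), p ≠ 2 ∧ IsOrdinaryAt W p ∧
      ∃ (N : ℕ) (_ : NeZero N) (f : CuspForm (CongruenceSubgroup.Gamma0 N) 2),
        IsNewformOf W f ∧
          (padicLFunction f (unitRoot W p : ℚ_[p])).order ≤ (W.mordellWeilRank : ℕ∞)

/-- (DOM) the Mazur–Tate–Teitelbaum direction of the comparison: complex zeros force `p`-adic
zeros, `r_an ≤ ord_{T=0} L_p(E,T)` at every good ordinary prime (known for `r_an ≤ 3`:
interpolation, `p`-adic functional-equation parity, Perrin-Riou 1987 with a torsion Heegner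
point; open from `r_an = 4`). -/
def PadicDominates : Prop :=
  ∀ (W : WeierstrassCurve ℚ) [W.IsElliptic] [W.IsGloballyMinimal] (p : ℕ) [Fact p.Prime],
    IsOrdinaryAt W p → ∀ {N : ℕ} [NeZero N] (f : CuspForm (CongruenceSubgroup.Gamma0 N) 2),
      IsNewformOf W f →
        (W.analyticRank : ℕ∞) ≤ (padicLFunction f (unitRoot W p : ℚ_[p])).order

/-- (UB) no excess rank — verbatim the shared crux `Squeeze.SqueezeUBR2`. -/
def UB : Prop :=
  ∀ (W : WeierstrassCurve ℚ) [W.IsElliptic], W.mordellWeilRank ≤ W.analyticRank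

/-- **First lemma of card `regular-prime-cut` (PROVED): the regular-prime cut of X.**
`ExistsRegularPrime → PAdicOrderKatoSideR2 → PadicDominates → UB → PAdicOrderThesisR2`. -/
theorem thesis_of_regularPrimeCut (hreg : ExistsRegularPrime) (hKato : PAdicOrderKatoSideR2)
    (hdom : PadicDominates) (hUB : UB) : PAdicOrderThesisR2 := by
  intro W _ _
  obtain ⟨p, hp, hp2, hord, N, hN, f, hf, hle⟩ := hreg W
  haveI : Fact p.Prime := hp
  haveI : NeZero N := hN
  have hK : (W.mordellWeilRank : ℕ∞) ≤ (padicLFunction f (unitRoot W p : ℚ_[p])).order :=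
    hKato W p hp2 hord f hf
  have heq : (padicLFunction f (unitRoot W p : ℚ_[p])).order = (W.mordellWeilRank : ℕ∞) :=
    le_antisymm hle hK
  have h1 : (W.analyticRank : ℕ∞) ≤ (padicLFunction f (unitRoot W p : ℚ_[p])).order :=
    hdom W p hord f hf
  have h2 : (W.mordellWeilRank : ℕ∞) ≤ (W.analyticRank : ℕ∞) := by exact_mod_cast hUB W
  refine ⟨p, hp, hord, N, hN, f, hf, ?_, heq⟩
  rw [heq] at h1 ⊢
  exact le_antisymm h2 h1

/-- The λ-form of E-regularity implies the order form used above: if some Taylor coefficient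
of index `k ≤ r` of a power series is non-zero then its order is `≤ r` (here over any
semiring; the card's hypothesis "`[T^k] L_p` is a `p`-adic unit" is the mod-`p` certificate of
non-vanishing). -/
theorem order_le_of_coeff_ne_zero {R : Type*} [Semiring R] (g : PowerSeries R) {k r : ℕ}
    (hk : k ≤ r) (h : PowerSeries.coeff k g ≠ 0) : g.order ≤ (r : ℕ∞) :=
  (PowerSeries.order_le k h).trans (by exact_mod_cast hk)


/-- (Λ_an, order form) every curve has an odd good ordinary prime with `ord_T L_p ≤ r_an` —
the `∃p`-form of the other inequality of the comparison crux #2 (in λ-form this is the summit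
card `lambda-minimal-prime-no-excess-rank`'s `Λ(f)`). -/
def ExistsAnalyticallySharpPrime : Prop :=
  ∀ (W : WeierstrassCurve ℚ) [W.IsElliptic] [W.IsGloballyMinimal],
    ∃ (p : ℕ) (_ : Fact p.Prime), p ≠ 2 ∧ IsOrdinaryAt W p ∧
      ∃ (N : ℕ) (_ : NeZero N) (f : CuspForm (CongruenceSubgroup.Gamma0 N) 2),
        IsNewformOf W f ∧
          (padicLFunction f (unitRoot W p : ℚ_[p])).order ≤ (W.analyticRank : ℕ∞)

/-- (LB) no deficit — the point-construction half of BSD-rank. -/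
def LB : Prop :=
  ∀ (W : WeierstrassCurve ℚ) [W.IsElliptic], W.analyticRank ≤ W.mordellWeilRank

/-- **Dual cut (PROVED): `ExistsAnalyticallySharpPrime → PAdicOrderKatoSideR2 → LB → X`.**
At a prime with `ord_T L_p ≤ r_an`, Kato gives `r_MW ≤ ord ≤ r_an` and LB closes the circle. -/
theorem thesis_of_sharpPrime_LB (hsh : ExistsAnalyticallySharpPrime)
    (hKato : PAdicOrderKatoSideR2) (hLB : LB) : PAdicOrderThesisR2 := by
  intro W _ _
  obtain ⟨p, hp, hp2, hord, N, hN, f, hf, hle⟩ := hsh W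
  haveI : Fact p.Prime := hp
  haveI : NeZero N := hN
  have hK : (W.mordellWeilRank : ℕ∞) ≤ (padicLFunction f (unitRoot W p : ℚ_[p])).order :=
    hKato W p hp2 hord f hf
  have h2 : (W.analyticRank : ℕ∞) ≤ (W.mordellWeilRank : ℕ∞) := by exact_mod_cast hLB W
  have hA : (padicLFunction f (unitRoot W p : ℚ_[p])).order = (W.analyticRank : ℕ∞) :=
    le_antisymm hle (h2.trans hK)
  have hM : (padicLFunction f (unitRoot W p : ℚ_[p])).order = (W.mordellWeilRank : ℕ∞) :=
    le_antisymm (hle.trans h2) hK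
  exact ⟨p, hp, hord, N, hN, f, hf, hA, hM⟩

/-- The two `∃p` hypotheses are linked: a regular prime and no-excess-rank give an analytically
sharp prime (the same prime). Pure bookkeeping. -/
theorem sharp_of_regular (hreg : ExistsRegularPrime) (hUB : UB) :
    ExistsAnalyticallySharpPrime := by
  intro W _ _
  obtain ⟨p, hp, hp2, hord, N, hN, f, hf, hle⟩ := hreg W
  haveI : Fact p.Prime := hp
  haveI : NeZero N := hN
  have h2 : (W.mordellWeilRank : ℕ∞) ≤ (W.analyticRank : ℕ∞) := by exact_mod_cast hUB W
  exact ⟨p, hp, hp2, hord, N, hN, f, hf, hle.trans h2⟩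


/-! ### What X adds to BSD-rank is exactly one E-regular prime

`X ⇔ BirchSwinnertonDyer ∧ Λ_MW` up to the parity of the witness prime (Λ_MW asks for an ODD
witness, as Kato's inequality is vendored for `p ≠ 2`). -/

/-- Λ_MW with the witness prime allowed to be `2` (the form X literally implies). -/
def ExistsRegularPrimeAny : Prop :=
  ∀ (W : WeierstrassCurve ℚ) [W.IsElliptic] [W.IsGloballyMinimal],
    ∃ (p : ℕ) (_ : Fact p.Prime), IsOrdinaryAt W p ∧
      ∃ (N : ℕ) (_ : NeZero N) (f : CuspForm (CongruenceSubgroup.Gamma0 N) 2),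
        IsNewformOf W f ∧
          (padicLFunction f (unitRoot W p : ℚ_[p])).order ≤ (W.mordellWeilRank : ℕ∞)

/-- X ⇒ Λ_MW(any witness) trivially (and X ⇒ `BirchSwinnertonDyer` by the route's deciding
theorem `closes` in the route file). -/
theorem regular_of_thesis (hX : PAdicOrderThesisR2) : ExistsRegularPrimeAny := by
  intro W _ _
  obtain ⟨p, hp, hord, N, hN, f, hf, -, hM⟩ := hX W
  exact ⟨p, hp, hord, N, hN, f, hf, hM.le⟩

/-- BSD-rank ∧ Λ_MW ⇒ X (PROVED): at the regular prime Kato squeezes `ord_T L_p = r_MW`, and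
BSD-rank supplies `r_an = r_MW`. So the thesis X exceeds the summit statement by EXACTLY the
existence of one E-regular odd ordinary prime per curve. -/
theorem thesis_of_bsd_regular (hreg : ExistsRegularPrime) (hKato : PAdicOrderKatoSideR2)
    (hBSD : _root_.BirchSwinnertonDyer) : PAdicOrderThesisR2 := by
  intro W hW _
  obtain ⟨p, hp, hp2, hord, N, hN, f, hf, hle⟩ := hreg W
  haveI : Fact p.Prime := hp
  haveI : NeZero N := hN
  have hK : (W.mordellWeilRank : ℕ∞) ≤ (padicLFunction f (unitRoot W p : ℚ_[p])).order :=
    hKato W p hp2 hord f hf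
  have hM : (padicLFunction f (unitRoot W p : ℚ_[p])).order = (W.mordellWeilRank : ℕ∞) :=
    le_antisymm hle hK
  have hr : W.analyticRank = W.mordellWeilRank := hBSD W hW
  exact ⟨p, hp, hord, N, hN, f, hf, hr ▸ hM, hM⟩

/-- DOM is implied by LB and Kato's inequality (at odd primes): `r_an ≤ r_MW ≤ ord_T L_p`. So in
the regular-prime cut DOM's only job is to REPLACE LB on the locus `r_an ≤ 3`, where DOM is a
theorem and LB is not. -/
theorem padicDominates_odd_of_LB (hLB : LB) (hKato : PAdicOrderKatoSideR2) :
    ∀ (W : WeierstrassCurve ℚ) [W.IsElliptic] [W.IsGloballyMinimal] (p : ℕ) [Fact p.Prime],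
      p ≠ 2 → IsOrdinaryAt W p →
        ∀ {N : ℕ} [NeZero N] (f : CuspForm (CongruenceSubgroup.Gamma0 N) 2), IsNewformOf W f →
          (W.analyticRank : ℕ∞) ≤ (padicLFunction f (unitRoot W p : ℚ_[p])).order := by
  intro W _ _ p _ hp2 hord N _ f hf
  have h1 : (W.analyticRank : ℕ∞) ≤ (W.mordellWeilRank : ℕ∞) := by exact_mod_cast hLB W
  exact h1.trans (hKato W p hp2 hord f hf)


/-- **The cleanest form (PROVED): X ⇒ LB-free residue.** Since Λ_an ⇒ UB (Kato) and
`thesis_of_sharpPrime_LB : Λ_an → Kato → LB → X`, while conversely X ⇒ Λ_an (below) and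
X ⇒ BSD ⇒ LB (route `closes`), the thesis X is EQUIVALENT to `LB ∧ Λ_an`: points, plus one
analytically sharp odd ordinary prime per newform (a statement about `f` alone). -/
theorem sharpAny_of_thesis (hX : PAdicOrderThesisR2) :
    ∀ (W : WeierstrassCurve ℚ) [W.IsElliptic] [W.IsGloballyMinimal],
      ∃ (p : ℕ) (_ : Fact p.Prime), IsOrdinaryAt W p ∧
        ∃ (N : ℕ) (_ : NeZero N) (f : CuspForm (CongruenceSubgroup.Gamma0 N) 2),
          IsNewformOf W f ∧
            (padicLFunction f (unitRoot W p : ℚ_[p])).order ≤ (W.analyticRank : ℕ∞) := by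
  intro W _ _
  obtain ⟨p, hp, hord, N, hN, f, hf, hA, -⟩ := hX W
  exact ⟨p, hp, hord, N, hN, f, hf, hA.le⟩

/-- UB from one analytically sharp prime (the summit card `lambda-minimal`'s implication, here in
order form against the route decls). PROVED. -/
theorem UB_of_sharp (hsh : ExistsAnalyticallySharpPrime) (hKato : PAdicOrderKatoSideR2) : UB := by
  intro W hW
  -- pass to a globally minimal model? `ExistsAnalyticallySharpPrime` is stated for globally
  -- minimal W only, exactly like X; so we prove UB for globally minimal W here and leave the
  -- minimal-model transport (ranks are invariant, facts `…_variableChange_holds`) to the glue,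
  -- as the route's `closes` does. To keep this lemma self-contained we state it for such W:
  exact UB_aux hsh hKato W hW
where
  /-- UB for globally minimal models from one sharp prime. -/
  UB_aux (hsh : ExistsAnalyticallySharpPrime) (hKato : PAdicOrderKatoSideR2)
      (W : WeierstrassCurve ℚ) (hW : W.IsElliptic) : W.mordellWeilRank ≤ W.analyticRank := by
    obtain ⟨C, hC⟩ := WeierstrassCurve.hasGlobalMinimalModel_rat_holds W
    haveI := hC
    obtain ⟨p, hp, hp2, hord, N, hN, f, hf, hle⟩ := hsh (C • W)
    haveI : Fact p.Prime := hp
    haveI : NeZero N := hN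
    have hK := hKato (C • W) p hp2 hord f hf
    have h : ((C • W).mordellWeilRank : ℕ∞) ≤ ((C • W).analyticRank : ℕ∞) := hK.trans hle
    have h' : (C • W).mordellWeilRank ≤ (C • W).analyticRank := by exact_mod_cast h
    rwa [WeierstrassCurve.analyticRank_variableChange_holds W C,
      WeierstrassCurve.mordellWeilRank_variableChange_holds W C] at h'

end Summit.BirchSwinnertonDyer.BirchSwinnertonDyer.Cruxes.PAdicOrderThesisR2.RegularPrimeCut
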